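import Literature.MathematicalPhysics.QuantumFieldTheory.Balaban1983to89.B9SmoothHolderClassPClosure
import Literature.MathematicalPhysics.QuantumFieldTheory.Balaban1983to89.B9SmoothHolderClassState

/-!
# `Balaban1983to89.B9SmoothHolderClassStateProducers` — PRODUCERS INTO THE REGULAR STATE CLASS `𝔖₂ = (Lʲη)⁻¹·bHZKPG g w`: the entry `G₀D_U : 𝔠_W⁽¹⁾ → 𝔖₂` of the
# (3.138) step from Theorem 3.3's (3.42)₃-type sup word (the certificate's `hZ8.1`∕`gD2`) and its (3.43) probe family (the certificate's `hpXDv`), and the entry `G₀ : 𝔠⁽⁰⁾ → 𝔖₂`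
# from `e0` and the probe family of G₀ itself (dag-n06-w6's `pX0_of_pins`) — every input already displayed or derived in the N06 certificate

T. Bałaban, *Propagators for lattice gauge theories in a background field*, Commun. Math. Phys. **99** (1985) 389–434 [`Balaban1985BackgroundPropagators`,
"B9"]; [4] = T. Bałaban, *Propagators and renormalization transformations for lattice gauge theories. II*, Commun. Math. Phys. **96** (1984) 223–250
[`Balaban1984PropagatorsII`].  statement-level skeleton of published theorems with citation tags; proofs where landed; nothing here is a claim about the
Yang–Mills mass gap.  Sequel of `B9SmoothHolderClassState` (dag-n06-l g26: the state class, its rescaling calculus and readings) and `B9SmoothHolderClassPClosure` (g24: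
INTO the print-weighted bond class from a sup member and a probe family).

THE PRINT.  Thm 3.3 p. 399 = Thm 3.1's (3.42)–(3.47) for G₀: (3.42)₃ *"|(G(U)∇\*_Uλ)(x)| ≦ B₀Lʲη e^{−δ₀d(y,y′)}|λ|"* (∇\* ↔ ∇ ↔ D_U conventional, p. 398), (3.43) *"‖ζG(U)∇\*_Uλ‖_β ≦
B₀(β)(Lʲη)^{1−β}e^{−δ₀d(y,y′)}|λ|"*; p. 398 (remark after (3.47)): the powers of Lʲη may be moved between the two localizations ([4] (2.60)).

THE POINT (dag-n06-l LOCATED-U8, `DELTA2-LETTERS-MEMO.md` §5–§6).  The step over the regular state (`B9Thm312WholeStepRegular.stepS_of_lettersS`) needs the two G₀-side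
entries INTO 𝔖₂: `G₀ : 𝔠⁽⁰⁾ → 𝔖₂` and `G₀D_U : 𝔠_W⁽¹⁾ → 𝔖₂`.  THIS FILE gives the second from members the N06 certificate ALREADY displays∕derives: the sup word
`G₀D_U : cNorm blkW 1 → cNorm blk 2` (`hZ8.1`, Theorem 3.3 (3.42)₃-type) and the (3.43) probe family `Φ^X_s∘G₀D_U : cNormR blkW 0 → cNormR blkPX (s − 1)` (`hpXDv`, ∀ s ∈ (0,1),
graded weights `w s·C_b(s) ≤ C_b₀`): ★★ `hasMaj_into_state_of_sup_probes` (generic operator `T` on the site carrier: sup word at dimension 2 + probe family at dimension 1 ⟹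
`T : cNorm blkW 1 → 𝔖₂`), by g24's `hasMaj_into_bHZKPG_of_probeFamily` at dimension 1 and ONE rescaling (γ = −1); ★★★ `hasMaj_into_state_of_sup_probes_zero` (the FIRST entry `G₀ :
cNorm blk 0 → 𝔖₂`: sup word `e0` + the probe family of G₀ ITSELF at dimension 2 — dag-n06-w6's `B9Thm33G0ProbeZeroAtCutPins.pX0_of_pins` from `e0` + `Thm33G0Dir.e1d`
(node00-def-Y g26 ANSWER, cell bus l.45750) — shifted to dimension 1, landed, rescaled back).
HONEST SCOPE.  Bookkeeping over landed objects; Theorem 3.3's members and the member facts are HYPOTHESES of printed species; nothing of [B9]∕[4] asserted; no pin, no certificate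
edit; COUNT-NEUTRAL; N06 NOT discharged; nothing continuum ∕ OS ∕ mass gap.  Cell `pub-ymgap` (HUMAN RULING D-0062), Track A node N06 [B9], bundle F7 rows 20–21, seat
`pub-ymgap-dag-n06-l` (g26), 2026-08-29.  NEW file; nothing landed is modified.
-/

noncomputable section

namespace Literature.MathematicalPhysics.QuantumFieldTheory.Balaban1983to89.B9SmoothHolderClassStateProducers

open B6Geom246MultiLevelTorus (geomT)
open B6GlobalChartV1 (PV blkV1)
open B6Ineq2142KLevelV1 (β lvl)
open B6KLevelCensusIndexV1 (KIdx)
open B6Prop22KLevelTorusCensusEta (nKT)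
open B9GeoNormsKLevelV1 (geo9K)
open B9Thm34Ext (toB6)
open B9SectDSup (weightNorm)
open B11SectG (BlockNorm HasMaj)
open B9Thm312Whole (GeoOK cNorm)
open B9Thm312WholeClasses (cNormR rwt rwt_nonneg cNormR_loc_neg_natCast hasMaj_toR)
open B9RWSums343to347Whole (Facts347)
open B9CoReadingCoords (XBK blkBK)
open B9CoReadingCoordsS (XSK sIK blkSK)
open B9CoReadingCoordsHolder (blkPK probeK w₀K)
open B9CoReadingCoordsHolderAdm (wKA)
open B9MultiscaleSmoothPartitionYNear (rNear)
open B9SmoothHolderClassP (bHZKPG)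
open B9SmoothHolderClassPClosure (hasMaj_into_bHZKPG_of_probeFamily)
open B9SmoothHolderClassState (hasMaj_rescale_src_cNormR)
open B9PerturbationMajorantAlgebra (hasMaj_shift hasMaj_weaken rpow_abs_eq_pow)
open Node00 (SiteY FBondY IBondY toKT)

variable {d ℓ : ℕ} {hd : 1 ≤ d + 1} {hL : Odd (ℓ + 1) ∧ 1 < ℓ + 1} {b₀ b₁ : ℝ}
variable {𝔸 : Type} [NormedRing 𝔸] [NormedAlgebra ℂ 𝔸]
variable {κ : Type} [Fintype κ]
variable (i : KIdx d ℓ hd hL b₀ b₁) [Fintype (geo9K i).Site] (b : Module.Basis κ ℝ 𝔸) (g : FBondY i → FBondY i → 𝔸ˣ) {R : ℝ} {H : Prop}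
variable (w : ℝ → ℝ) (hw0 : ∀ s, 0 ≤ w s) (hw1 : ∀ s, w s ≤ 1)

/-- ★★ **INTO THE STATE CLASS FROM A SUP WORD AT DIMENSION 2 AND A (3.43) PROBE FAMILY** — the entry `G₀D_U : 𝔠_W⁽¹⁾ → 𝔖₂` of the (3.138) step.  For any operator `T` from the site
carrier to the bond carrier (`T = G0 ∘ Dv` at the pins): the sup word `T : cNorm (blkSK (sIK bI)) 1 → cNorm (blkBK bI) 2` (`B·e^{−δ₁d}` — the certificate's `hZ8.1`) and the probe
family `probeK b g (wKA s) (w₀K s) ∘ T : cNormR blkSK 0 → cNormR (blkPK bI) (s − 1)` (`C_b(s)·e^{−δd}` ∀ s ∈ (0,1), `w s·C_b(s) ≤ C_b₀` — the certificate's `hpXDv` along the class's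
table `g`) give `T : cNorm (blkSK (sIK bI)) 1 → (Lʲη)⁻¹·bHZKPG g w` with `L·(B·L + C_b₀)·e^{δ(r_near+1)}·L·e^{−(δ−αδ_F)d}` (0 ≤ δ, δ + αδ_F ≤ δ₁).
[cite: Balaban1985BackgroundPropagators, Thm 3.3 p.399 + (3.42)–(3.43) pp.397–398 + p.398 (remark after (3.47)); Balaban1984PropagatorsII, (2.51)–(2.54) pp.232–233, Lemma 2.1 (2.60) p.234] -/
theorem hasMaj_into_state_of_sup_probes (hG : GeoOK (geo9K i)) {dF : ℕ} {δF α L₀ : ℝ} (hF : Facts347 (geo9K i) R H dF δF α L₀)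
    {bI : FBondY i → IBondY i} (hβ1 : ∀ f : FBondY i, (geomT i.D).dist (β i.hN i.D i.hk (bI f)) (blkV1 i.hN i.D f) ≤ 1)
    (hlev : ∀ f : FBondY i, lvl i.hN i.D i.hk (bI f) = (blkV1 i.hN i.D f).1.1) (hbI0 : ∀ f : FBondY i, bI f = bI ⟨f.src, 0⟩)
    (hcf : |i.cf| = (nKT (toKT i) : ℝ)) {T : (XSK κ i → ℝ) →ₗ[ℝ] (XBK κ i → ℝ)} {B δ₁ δ Cb₀ : ℝ} {Cb : ℝ → ℝ}
    (hB : 0 ≤ B) (hCb₀ : 0 ≤ Cb₀) (hCb : ∀ s, 0 < s → s < 1 → 0 ≤ Cb s) (hwCb : ∀ s, 0 < s → s < 1 → w s * Cb s ≤ Cb₀)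
    (hδ : 0 ≤ δ) (hδ₁ : δ + α * δF ≤ δ₁)
    (hsup : HasMaj (cNorm R H (blkSK i (sIK i bI)) hG.lenle 1) (cNorm R H (blkBK i bI) hG.lenle 2) T (fun a a' => B * Real.exp (-(δ₁ * (geo9K i).dist a a'))))
    (hpr : ∀ s, 0 < s → s < 1 → HasMaj (cNormR R H (blkSK i (sIK i bI)) hG.lenle 0) (cNormR R H (blkPK bI) hG.lenle (s - 1))
      (probeK b g (wKA i s) (w₀K i s) ∘ₗ T) (fun a a' => Cb s * Real.exp (-(δ * (geo9K i).dist a a')))) :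
    HasMaj (cNorm R H (blkSK i (sIK i bI)) hG.lenle 1)
      (weightNorm (bHZKPG (κ := κ) i b g (R := R) (H := H) w hw0 hw1) (rwt (geo9K i) (-1)) (rwt_nonneg hG.lenle (-1))) T
      (fun a a' => ((ℓ + 1 : ℕ) : ℝ) * (B * (geo9K i).L + Cb₀) * Real.exp (δ * (rNear d ℓ + 1)) * (geo9K i).L *
        Real.exp (-((δ - α * δF) * (geo9K i).dist a a'))) := by
  have hL0 : 0 ≤ (geo9K i).L := le_trans zero_le_one hF.one_le_L
  -- the sup word at real weights, shifted to the source weight 0: `cNormR blkSK 0 → cNormR blkBK (−1)`, constant B·L, rate δ₁ − αδ_F ≥ δ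
  have h1 := hasMaj_toR hG hsup
  rw [Nat.cast_one, Nat.cast_ofNat] at h1
  have h2 := hasMaj_shift hG hF (1 : ℝ) (by norm_num) hB h1
  rw [rpow_abs_eq_pow (geo9K i).L 1 1 (by norm_num), pow_one, show (-1 : ℝ) + 1 = 0 by norm_num, show (-2 : ℝ) + 1 = -1 by norm_num] at h2
  have h3 := hasMaj_weaken hG (mul_nonneg hB hL0) le_rfl (show δ ≤ δ₁ - α * δF by linarith) h2
  -- INTO the dimension-1 graded class along `g`
  have h4 := hasMaj_into_bHZKPG_of_probeFamily i b g hG.lenle w hw0 hw1 hβ1 hlev hbI0 hδ hcf (mul_nonneg hB hL0) hCb₀ hCb hwCb h3 hpr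
  -- ONE rescaling (γ = −1): source `cNormR blkSK (−1) = cNorm blkSK 1`, target the state class
  have hK : 0 ≤ ((ℓ + 1 : ℕ) : ℝ) * (B * (geo9K i).L + Cb₀) * Real.exp (δ * (rNear d ℓ + 1)) := by positivity
  have h5 := hasMaj_rescale_src_cNormR hG hF (-1 : ℝ) (by norm_num) hK h4
  rw [rpow_abs_eq_pow (geo9K i).L (-1) 1 (by norm_num), pow_one, show (0 : ℝ) + -1 = -((1 : ℕ) : ℝ) by norm_num] at h5
  intro y' μ hμ y
  have hb := h5 y' μ hμ y
  rwa [cNormR_loc_neg_natCast hG] at hb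

/-- ★★★ **INTO THE STATE CLASS FROM A SUP WORD AND A PROBE FAMILY AT DIMENSION 2 — the entry `G₀ : 𝔠⁽⁰⁾ → 𝔖₂` of the (3.138) step.**  For any operator `T` into the bond
carrier from a carrier `V` with blocks `blkV` (`T = G0` at the pins, `blkV = blkBK bI`): the sup word `T : cNorm blkV 0 → cNorm (blkBK bI) 2` (`B·e^{−δ₁d}` — Theorem 3.3 (3.42)₁,
the certificate's `e0` read by `hasMaj_G0_cNorm`) and the probe family `probeK b g (wKA s) (w₀K s) ∘ T : cNormR blkV 0 → cNormR (blkPK bI) (s − 2)` (`C_b(s)·e^{−δ₂d}` ∀ s ∈ (0,1),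
`w s·C_b(s) ≤ C_b₀` — dag-n06-w6's `B9Thm33G0ProbeZeroAtCutPins.pX0_of_pins` from `e0` + `Thm33G0Dir.e1d`, the type of `Thm33G0DirX.pX0`) give
`T : cNorm blkV 0 → (Lʲη)⁻¹·bHZKPG g w` with `L·(B·L + C_b₀·L)·e^{δ(r_near+1)}·L·e^{−(δ−αδ_F)d}` (0 ≤ δ, δ + αδ_F ≤ min(δ₁, δ₂)): shift to dimension 1, land (g24), rescale back.
[cite: Balaban1985BackgroundPropagators, Thm 3.3 p.399 + (3.42)–(3.43) pp.397–398 + p.398 (remark after (3.47)); Balaban1984PropagatorsII, (2.51)–(2.54) pp.232–233, Lemma 2.1 (2.60) p.234] -/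
theorem hasMaj_into_state_of_sup_probes_zero (hG : GeoOK (geo9K i)) {dF : ℕ} {δF α L₀ : ℝ} (hF : Facts347 (geo9K i) R H dF δF α L₀)
    {bI : FBondY i → IBondY i} (hβ1 : ∀ f : FBondY i, (geomT i.D).dist (β i.hN i.D i.hk (bI f)) (blkV1 i.hN i.D f) ≤ 1)
    (hlev : ∀ f : FBondY i, lvl i.hN i.D i.hk (bI f) = (blkV1 i.hN i.D f).1.1) (hbI0 : ∀ f : FBondY i, bI f = bI ⟨f.src, 0⟩)
    (hcf : |i.cf| = (nKT (toKT i) : ℝ)) {V : Type} [Fintype V] {blkV : V → IBondY i} {T : (V → ℝ) →ₗ[ℝ] (XBK κ i → ℝ)}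
    {B δ₁ δ₂ δ Cb₀ : ℝ} {Cb : ℝ → ℝ}
    (hB : 0 ≤ B) (hCb₀ : 0 ≤ Cb₀) (hCb : ∀ s, 0 < s → s < 1 → 0 ≤ Cb s) (hwCb : ∀ s, 0 < s → s < 1 → w s * Cb s ≤ Cb₀)
    (hδ : 0 ≤ δ) (hδ₁ : δ + α * δF ≤ δ₁) (hδ₂ : δ + α * δF ≤ δ₂)
    (hsup : HasMaj (cNorm R H blkV hG.lenle 0) (cNorm R H (blkBK i bI) hG.lenle 2) T (fun a a' => B * Real.exp (-(δ₁ * (geo9K i).dist a a'))))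
    (hpr : ∀ s, 0 < s → s < 1 → HasMaj (cNormR R H blkV hG.lenle 0) (cNormR R H (blkPK bI) hG.lenle (s - 2))
      (probeK b g (wKA i s) (w₀K i s) ∘ₗ T) (fun a a' => Cb s * Real.exp (-(δ₂ * (geo9K i).dist a a')))) :
    HasMaj (cNorm R H blkV hG.lenle 0)
      (weightNorm (bHZKPG (κ := κ) i b g (R := R) (H := H) w hw0 hw1) (rwt (geo9K i) (-1)) (rwt_nonneg hG.lenle (-1))) T
      (fun a a' => ((ℓ + 1 : ℕ) : ℝ) * (B * (geo9K i).L + Cb₀ * (geo9K i).L) * Real.exp (δ * (rNear d ℓ + 1)) * (geo9K i).L *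
        Real.exp (-((δ - α * δF) * (geo9K i).dist a a'))) := by
  have hL0 : 0 ≤ (geo9K i).L := le_trans zero_le_one hF.one_le_L
  -- the sup word at real weights, shifted to dimension 1: `cNormR blkV 1 → cNormR blkBK (−1)`, constant B·L, rate ≥ δ
  have h1 := hasMaj_toR hG hsup
  rw [Nat.cast_zero, neg_zero, Nat.cast_ofNat] at h1
  have h2 := hasMaj_shift hG hF (1 : ℝ) (by norm_num) hB h1
  rw [rpow_abs_eq_pow (geo9K i).L 1 1 (by norm_num), pow_one, show (0 : ℝ) + 1 = 1 by norm_num, show (-2 : ℝ) + 1 = -1 by norm_num] at h2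
  have h3 := hasMaj_weaken hG (mul_nonneg hB hL0) le_rfl (show δ ≤ δ₁ - α * δF by linarith) h2
  -- the probe family shifted to dimension 1: `cNormR blkV 1 → cNormR blkPK (s − 1)`, constants C_b(s)·L, rate ≥ δ
  have hpr' : ∀ s, 0 < s → s < 1 → HasMaj (cNormR R H blkV hG.lenle 1) (cNormR R H (blkPK bI) hG.lenle (s - 1))
      (probeK b g (wKA i s) (w₀K i s) ∘ₗ T) (fun a a' => Cb s * (geo9K i).L * Real.exp (-(δ * (geo9K i).dist a a'))) := by
    intro s hs0 hs1
    have h := hasMaj_shift hG hF (1 : ℝ) (by norm_num) (hCb s hs0 hs1) (hpr s hs0 hs1)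
    rw [rpow_abs_eq_pow (geo9K i).L 1 1 (by norm_num), pow_one, show (0 : ℝ) + 1 = 1 by norm_num, show s - 2 + 1 = s - 1 by ring] at h
    exact hasMaj_weaken hG (mul_nonneg (hCb s hs0 hs1) hL0) le_rfl (show δ ≤ δ₂ - α * δF by linarith) h
  have hwCb' : ∀ s, 0 < s → s < 1 → w s * (Cb s * (geo9K i).L) ≤ Cb₀ * (geo9K i).L := fun s hs0 hs1 => by
    rw [← mul_assoc]; exact mul_le_mul_of_nonneg_right (hwCb s hs0 hs1) hL0
  -- INTO the dimension-1 graded class along `g`, from the source `cNormR blkV 1`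
  have h4 := hasMaj_into_bHZKPG_of_probeFamily i b g hG.lenle w hw0 hw1 hβ1 hlev hbI0 hδ hcf (mul_nonneg hB hL0) (mul_nonneg hCb₀ hL0)
    (fun s hs0 hs1 => mul_nonneg (hCb s hs0 hs1) hL0) hwCb' h3 hpr'
  -- rescale back (γ = −1): source `cNormR blkV 0 = cNorm blkV 0`, target the state class
  have hK : 0 ≤ ((ℓ + 1 : ℕ) : ℝ) * (B * (geo9K i).L + Cb₀ * (geo9K i).L) * Real.exp (δ * (rNear d ℓ + 1)) := by positivity
  have h5 := hasMaj_rescale_src_cNormR hG hF (-1 : ℝ) (by norm_num) hK h4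
  rw [rpow_abs_eq_pow (geo9K i).L (-1) 1 (by norm_num), pow_one, show (1 : ℝ) + -1 = -((0 : ℕ) : ℝ) by norm_num] at h5
  intro y' μ hμ y
  have hb := h5 y' μ hμ y
  rwa [cNormR_loc_neg_natCast hG] at hb

end Literature.MathematicalPhysics.QuantumFieldTheory.Balaban1983to89.B9SmoothHolderClassStateProducers

end
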